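import Mathlib
import HarnessLib
import Literature.Analysis.FluidPDE.VorticityCalculus
import Summits.NavierStokesRegularity.NavierStokesRegularity.Theses.PoloidalWindowDoor
import Summits.NavierStokesRegularity.NavierStokesRegularity.Theses.LoopPeriodRatchet
import Summits.NavierStokesRegularity.NavierStokesRegularity.Theorems.PoloidalWindowDoorPoloidalWindowRigidityWindow
import Summits.NavierStokesRegularity.NavierStokesRegularity.Theorems.SymmetryModuliCountSymmetricLiouville
import Summits.NavierStokesRegularity.NavierStokesRegularity.Theorems.FrequencyGrowthExponent.Negative.Rigidity
import Summits.NavierStokesRegularity.NavierStokesRegularity.Theorems.ClockStretchingLawClockCeilingGermRigidity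
import Summits.NavierStokesRegularity.NavierStokesRegularity.Theorems.PoloidalWindowDoorPoloidalWindowRigidityUniformReturnWindowGap
import Summits.NavierStokesRegularity.NavierStokesRegularity.Theorems.PoloidalWindowDoorPoloidalWindowRigidityUniformReturnReturnWindowSmall

/-!
# LINE 22 `uniform_return` — the RECURRENT LEAF made UNIFORM: asymptotic translation symmetry is an exact symmetry of a blow-down (v1.1)

Ideator `ns-idea-8` g11 (lens «barrier»: the precisely-typed statement JUST OUTSIDE a killed technique class), THICK column of rung N0,
cruxes `PoloidalWindowRigidity` ⟨stmt-NavierStokesRegularity-19708⟩ / `LrcModEntire` ⟨…-20428⟩.  Files-only (KEY-NS #68/#69): this skeleton is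
NOT registered over the LEAD's; it composes INTO LINE 21 `hot_hull` v1.6 (4c0d8ef60d09) by concluding its research cell `CellRecurrentLeaf`
(statement VERBATIM below) from ONE typed residue.  NO SUMMIT, NO CRUX AND NO RESEARCH CELL OF RECORD IS PROVED BY THIS LINE.

## Why this line (bears_on: N0 · THICK column · hot_hull's RECURRENT-LEAF; instrument row: Liouville-by-blow-down / KNSS Thm 6.2 class)

The killed class next to RECURRENT-LEAF is EXACT SYMMETRY: a class profile that is periodic in one direction vanishes (tree, BY NAME:
`FrequencyGrowthExponent.Negative.eq_zero_of_periodic` = `SymmetryModuliCountSymmetricLiouville.periodicTypeIAncientLiouville`: blow-down ⇒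
shrinking periods ⇒ line-invariant limit ⇒ KNSS 2.5D Liouville ⇒ small at `−∞` ⇒ Kato gap), and two class profiles that agree on an open set at ONE
time agree on the whole past (tree `germRigidity`, joint real-analyticity).  hot_hull v1.5 named as the cell's cheapest falsifier «a translation-
periodic member of 𝒫 with a persistent hot vortex line» — by the first theorem THERE IS NONE (corner `periodicReturn_absurd` below, proved by name),
and by the second even ONE return that is exact on ONE open ball at ONE time is fatal (corner `germReturn_absurd`, proved by name).

The statement JUST OUTSIDE that class, typed here, is UNIFORM RETURN: `UniformReturn U := ∀ ε > 0, ∀ R, ∃ τ, R ≤ ‖τ‖ ∧ ∀ t < 0, ∀ x,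
√(−t)‖U(t, x+τ) − U(t, x)‖ ≤ ε` — the profile has translation symmetries IN THE LIMIT, along an escaping sequence, measured in the GLOBAL
scale-covariant sup-metric (periodic ⇒ quasi-periodic ⇒ Bohr-almost-periodic-in-a-direction ⇒ UniformReturn).  hot_hull's H6 (Birkhoff) gives the
RECURRENT LEAF exactly this with the global metric replaced by the COMPACT-OPEN one (syndetic `(ε,R)`-returns on `[−R,−1/R] × B̄_R`).  The lever:

* **U1 `uniformReturn_liouville` (PROVED here from two M-sized hand stubs)** — a class profile with UniformReturn vanishes identically.  Blow DOWN at
  the scale of the n-th approximate period `τₙ` (not, as in the periodic proof, at an arbitrary scale): the rescaled approximate period `τₙ/λₙ` has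
  norm in `[½,1]`, the scale-covariant defect `εₙ` is scale-invariant, so every F3-limit (`classCompactness`) is EXACTLY periodic with a period of norm
  in `[½,1]`, hence `0` by the periodic Liouville BY NAME; therefore `√(−t)‖U(t)‖_∞ → 0` on the time WINDOWS `[−4‖τₙ‖², −‖τₙ‖²]` (U1a
  `ReturnWindowSmall`); and smallness `≤ ε ≤ ε₁` on ONE window `[−4T,−T]` propagates to `≤ 2ε` on `[−4T, 0)` by re-running the Chae–Wolf/Koch–Tataru
  bootstrap of the tree's gap theorem `SymmetricLiouville.Negative.exists_eps_small_vanishes` forward in geometric time steps (U1b `WindowGap`).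
  U1a ∧ U1b ⇒ U1 is checked below (no sorry).
* **Corners BY NAME (no sorry)**: `periodicReturn_absurd` (an exactly periodic pinned profile is absurd: `eq_zero_of_periodic` vs `N ≠ 0`);
  `germReturn_absurd` (a pinned profile one of whose translates agrees with it on a non-empty open set at one time is absurd: `germRigidity` +
  `isTypeIAncientMild_comp_add_right` make it periodic); `pinned_not_uniformReturn` (COLUMN-WIDE export: every pinned profile — every research cell of
  hot_hull / hot_forest / hot_split, S0's profiles, the wall's `W` — may assume `¬ UniformReturn`, from U1).
* **The cut of RECURRENT-LEAF (kernel `cellRecurrentLeaf_of_defective`, no sorry)**: `CellRecurrentLeaf` ⇐ `CellUniformReturnLeaf` (PROVED from U1)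
  ∧ `CellDefectiveReturnLeaf` (OPEN, research — RECURRENT-LEAF plus `¬ UniformReturn U`: every escaping translation, in particular every hull
  return of H6, carries a GLOBAL scale-covariant DEFECT `≥ ε₀ > 0`; since the hull returns converge on compacta, the defect is realised at space-time
  points ESCAPING EVERY COMPACT subset of `(−∞,0) × ℝ³` — far field `|x| → ∞` at bounded times, far past `t → −∞`, or the blow-up corner `t → 0⁻`;
  v1.1 menu: the third alternative at bounded `x` is excluded by local forward continuous dependence of class profiles with `O(1/R)` Oseen leakage).

So the THICK world's last escaping configuration is now: an almost-periodic vortex leaf whose almost-periods are good on every compact space-time set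
and BAD somewhere at infinity, for every one of them — B-g8-3 («blow-down at the pin loses the window») turned from an obstruction into the typed
residue: the defect lives exactly where the pin cannot see.

## Why NOVEL relative to the listed lines (Lines/ of this crux, 64 files; PICKED = lrc-jet v5)

No registered line uses a Liouville-by-blow-down step on the THICK column (hot_loops/thread_axis/clock: loop periods; hot_split/leaf_uniform/
hot_forest/hot_hull: slice kinematics + pins + hull compactness + Birkhoff; zero_mode: box means; null_leaf: 2-jets at vorticity zeros; entire_slices/
string_shells: (TH) spectral).  Nearest tree statements: `periodicTypeIAncientLiouville` / `eq_zero_of_periodic` (EXACT period, any scale of blow-down)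
and `rssFarFieldVanishing` (far-field RE-CENTRING of rotated self-similar profiles) — delta: symmetry only IN THE LIMIT along ONE escaping sequence,
blow-down AT the symmetry's own scale, plus a windowed gap propagation; `rg -l "UniformReturn|asymptotic.*period|approximate period|almost.periodic"
Theorems/` = no Liouville of this shape (the `almostPeriodic` hits are oscillator/ODE files).  Dead lists honoured: no pointwise pin, no slice identity,
no zero-mode, no sup-comparison, no frequency functional (B-g8-1…5, B-g9-1…6, B-g10-1/2); blow-down is used AWAY from the pin (at scale `‖τₙ‖ → ∞`,
free centring), which is exactly what B-g8-3 allows.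

## Cheapest falsifier · kill-switch · honest label

Cheapest falsifier of U1a: the limit period must be NON-ZERO — guaranteed by blowing down at `λₙ = √(−sₙ) ∈ [‖τₙ‖, 2‖τₙ‖]` (so `‖τₙ/λₙ‖ ∈ [½,1]`), NOT
at an unrelated scale (at scale `≫ ‖τₙ‖` the period shrinks to `0` and only line-invariance of the limit survives IF the defects summed along
multiples stay small — they do not: `k` multiples cost `kεₙ`).  Cheapest falsifier of U1b: the heat part of the Oseen identity from `4t` to `t`
contracts the scale-covariant size by exactly `√(−t)/√(−4t) = ½` — the same constant as in `exists_eps_small_vanishes`; the forward step uses the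
a-priori Type-I bound on the short unknown stretch `[t₁, t₁(1−η)]`, `η = η(C, ε)`.  Kill-switch of the LINE: none by example (no non-zero class
profile is known — every explicit candidate is periodic/quasi-periodic/self-similar and dead by name); the line DIES AS A CONTRIBUTION if the critic
rules UniformReturn «extrinsic» — answer of record: it is H6's recurrence with the compact-open metric replaced by the uniform scale-covariant one, and
the residue says precisely which of the two the refuter's object must fail.
HONEST LABEL: «barrier inversion of the periodic Type-I Liouville: ONE new provable Liouville lemma (U1 ⇐ U1a + U1b, both M, tree templates
`periodicBlowdownVanishing_axis` / `exists_eps_small_vanishes`), two corners and a column-wide export BY NAME, RECURRENT-LEAF re-cut with a proved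
half; the residue DEFECTIVE-RETURN-LEAF is OPEN and no summit / crux / cell of record is proved.»

Sorry inventory (v1.0): `stub_returnWindowSmall` (U1a, M, hand), `stub_windowGap` (U1b, M, hand), `stub_cellDefectiveReturnLeaf` (research) — 3.

v1.1 (2026-08-29, maintenance — no statement changed): U1b `stub_windowGap` and U1a `stub_returnWindowSmall` WIRED BY NAME to ns-es-p1 g8's landed
`…Theorems.PoloidalWindowDoorPoloidalWindowRigidityUniformReturnWindowGap.windowGap` (p705972, commit 9fcb5b2ba241) and
`…Theorems.PoloidalWindowDoorPoloidalWindowRigidityUniformReturnReturnWindowSmall.returnWindowSmall` (p706563, commit 0372ed031805), statements VERBATIM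
(term-mode, δ-unfolding of the Cruxes-local defs); so U1 `uniformReturn_liouville`, `pinned_not_uniformReturn`, `cellUniformReturnLeaf_of` and the kernel
`cellRecurrentLeaf_of_stubs` carry NO sorry beyond the research cell.  Sorry inventory (v1.1): `stub_cellDefectiveReturnLeaf` (research) — 1.
No summit / crux / cell of record is proved.
-/

open scoped InnerProductSpace RealInnerProductSpace Laplacian

-- the summit and its single sub-problem share the name (CONVENTIONS §1)
set_option linter.dupNamespace false

namespace Summit.NavierStokesRegularity.NavierStokesRegularity.Cruxes.PoloidalWindowRigidity.UniformReturn

open Set Function MeasureTheory Filter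
open Literature.Analysis Literature.Analysis.FluidPDE
open Summit.NavierStokesRegularity.NavierStokesRegularity.Theses.PoloidalWindowDoor
open Summit.NavierStokesRegularity.NavierStokesRegularity.Theorems

/-! ## §1 The hypothesis packages (VERBATIM hot_hull v1.6 = hot_split v1.6 = leaf_uniform v1.3.1) -/

/-- **Pinned** — VERBATIM hot_split: Type-I decay, continuity, mild identity, div-free, e₃-poloidal, `N := v₂(−1,0) ≠ 0`, the global bound
`√(−t)|v₂| ≤ |N|`, `∇v₂(−1,0) = 0`, the time and Laplace pins. -/
def Pinned (C : ℝ) (v : ℝ → EuclideanSpace ℝ (Fin 3) → EuclideanSpace ℝ (Fin 3)) : Prop :=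
  Literature.Analysis.FluidPDE.HasTypeITimeDecay C v ∧
  ContinuousOn (Function.uncurry v) (Set.Iio (0 : ℝ) ×ˢ Set.univ) ∧
  (∀ s t : ℝ, s < t → t < 0 → ∀ x, v t x =
    Literature.Analysis.UnboundedOperators.heatExtension (v s) (t - s) x -
      Literature.Analysis.FluidPDE.oseenDuhamel 1 s v v t x) ∧
  (∀ t < 0, Literature.Analysis.FluidPDE.VectorCalculus.IsDivFree (v t)) ∧
  (∀ s < 0, ∀ y, ⟪Literature.Analysis.FluidPDE.curl (v s) y, EuclideanSpace.single 2 1⟫_ℝ = 0) ∧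
  v (-1) 0 2 ≠ 0 ∧ (∀ t < 0, ∀ x, Real.sqrt (-t) * |v t x 2| ≤ |v (-1) 0 2|) ∧
  (∀ h : EuclideanSpace ℝ (Fin 3), fderiv ℝ (v (-1)) 0 h 2 = 0) ∧
  (deriv (fun s => v s 0 2) (-1) = v (-1) 0 2 / 2 ∧ v (-1) 0 2 * (Δ (fun y => v (-1) y 2)) 0 ≤ 0)

/-- **ThickWindow** — VERBATIM hot_split. -/
def ThickWindow (v : ℝ → EuclideanSpace ℝ (Fin 3) → EuclideanSpace ℝ (Fin 3)) (W : Set (ℝ × EuclideanSpace ℝ (Fin 3))) : Prop :=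
  IsOpen W ∧ W ⊆ Set.Iio (0 : ℝ) ×ˢ Set.univ ∧
  (∀ z ∈ W, (Literature.Analysis.FluidPDE.curl (v z.1) z.2 ≠ 0 ∧
      (fderiv ℝ (v z.1) z.2 (EuclideanSpace.single 0 1) 2 ≠ 0 ∨ fderiv ℝ (v z.1) z.2 (EuclideanSpace.single 1 1) 2 ≠ 0) ∧
      (fderiv ℝ (v z.1) z.2 (EuclideanSpace.single 2 1) 0 ≠ 0 ∨ fderiv ℝ (v z.1) z.2 (EuclideanSpace.single 2 1) 1 ≠ 0)) ∧
    (fderiv ℝ (fun x => fderiv ℝ (v z.1) x (EuclideanSpace.single 2 1) 2) z.2 (EuclideanSpace.single 0 1) *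
          fderiv ℝ (v z.1) z.2 (EuclideanSpace.single 1 1) 2 -
        fderiv ℝ (fun x => fderiv ℝ (v z.1) x (EuclideanSpace.single 2 1) 2) z.2 (EuclideanSpace.single 1 1) *
          fderiv ℝ (v z.1) z.2 (EuclideanSpace.single 0 1) 2 ≠ 0)) ∧
  (∀ m : ℝ → ℝ → ℝ, ∀ W₁ : Set (ℝ × EuclideanSpace ℝ (Fin 3)), W₁ ⊆ W → IsOpen W₁ → W₁.Nonempty →
      ∃ z ∈ W₁, ∃ b : Fin 3, b ≠ 2 ∧
        fderiv ℝ (v z.1) z.2 (EuclideanSpace.single 2 1) b ≠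
          m z.1 (z.2 2) * fderiv ℝ (v z.1) z.2 (EuclideanSpace.single b 1) 2) ∧
  (∀ r : ℝ, 0 < r → (Metric.ball ((-1 : ℝ), (0 : EuclideanSpace ℝ (Fin 3))) r ∩ W).Nonempty)

/-- **Peakless** — VERBATIM hot_split: no island bracket of `σ·v₂(s,·)` on any horizontal plane at any time `s < 0`. -/
def Peakless (v : ℝ → EuclideanSpace ℝ (Fin 3) → EuclideanSpace ℝ (Fin 3)) : Prop :=
  ∀ (s z₀ σ M : ℝ) (K O : Set (EuclideanSpace ℝ (Fin 3))), s < 0 →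
    ((σ = 1 ∨ σ = -1) ∧ IsCompact K ∧ K.Nonempty ∧ (∀ y ∈ K, y 2 = z₀ ∧ σ * v s y 2 = M) ∧
      IsOpen O ∧ K ⊆ O ∧ (∀ y ∈ O, y 2 = z₀ → σ * v s y 2 ≤ M) ∧
      (∀ y ∈ O, y 2 = z₀ → σ * v s y 2 = M → y ∈ K)) → False

/-- The HOT SET of the hot-spot plane `P₀ = {y₂ = 0}` at time `−1` — VERBATIM hot_split: `H := {y : y₂ = 0, v₂(−1,y) = v₂(−1,0)}`. -/
def hotSet (v : ℝ → EuclideanSpace ℝ (Fin 3) → EuclideanSpace ℝ (Fin 3)) : Set (EuclideanSpace ℝ (Fin 3)) :=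
  {y | y 2 = 0 ∧ v (-1) y 2 = v (-1) 0 2}

/-! ## The leaf-uniform quantities (second derivatives of `w := v₂(−1,·)` in the column's nested-`fderiv` convention) -/

/-- `∂_b∂_a v₂(−1,·)(y)` — the second derivative of the vertical component of the time-`−1` slice, nested `fderiv` convention of the column. -/
noncomputable def hess (v : ℝ → EuclideanSpace ℝ (Fin 3) → EuclideanSpace ℝ (Fin 3)) (y a b : EuclideanSpace ℝ (Fin 3)) : ℝ :=
  fderiv ℝ (fun x => fderiv ℝ (fun x' => v (-1) x' 2) x a) y b

/-- `Δₕv₂(−1,·)(y) = ∂₀₀v₂ + ∂₁₁v₂` — the HORIZONTAL Laplacian of the vertical component at time `−1`. -/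
noncomputable def lapH (v : ℝ → EuclideanSpace ℝ (Fin 3) → EuclideanSpace ℝ (Fin 3)) (y : EuclideanSpace ℝ (Fin 3)) : ℝ :=
  hess v y (EuclideanSpace.single 0 1) (EuclideanSpace.single 0 1) + hess v y (EuclideanSpace.single 1 1) (EuclideanSpace.single 1 1)

/-! ## hot_hull v1.6 research cell RECURRENT-LEAF (VERBATIM — the target this line concludes) -/
/-- **CELL RECURRENT-LEAF `CellRecurrentLeaf` (OPEN, research) — the uniformly persistent escaping end after BIRKHOFF.**  A pinned THICK peakless profile
`U` with its hot laws in hand (frozen vorticity, closed critical hot set, R3, R4, time pin R10, Laplacian sign R9, no hot cycle F1a, separatrix F2), a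
COMPLETE HOT LEAF `γU` through the pin `0` with `|ω_U(−1, γU σ)| ≥ δ > 0` for ALL `σ ∈ ℝ` (hence — derivable, not supplied — `γU` is injective by F1a and
ESCAPING AT BOTH ENDS by R19, and the ridge / curtain laws R8/R11/R16 hold along it by name), which is RECURRENT IN BOTH DIRECTIONS UNDER SLIDING: the
re-centred profiles `U(·, · + γU(σₖ))` converge back to `U` locally uniformly (all slices, the vorticity slice, the re-based leaves) along some `σₖ → +∞`
AND along some `σₖ' → −∞`, with SYNDETIC return times (for every `ε, R` a length `L` such that every leaf-time window of length `L` contains an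
`(ε,R)`-return).  So the THICK world's last escaping configuration is an ALMOST-PERIODIC VORTEX LEAF: an unbounded injective planar curve along which the
whole Type-I ancient profile repeats itself up to `ε` within bounded leaf-time, carrying `v₂ = N`, `∇v₂ = 0`, `∂ₜv₂ = N/2`, `N·Δₕv₂ ≤ 0` and the two leaf
invariants.  Killing quantity missing (honest; B-g9-4(iii), B-g10-2): recurrence converts ANY leaf-monotone functional into a leaf-CONSTANT one — the cell
is the typed meeting point for such a functional (none is known), or for a Liouville theorem for Type-I ancient solutions that are recurrent along an
unbounded curve of non-decay (`|U₂(−1, γU σ)| = |N|` for all `σ`, `|γU σ| → ∞`). -/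
def CellRecurrentLeaf : Prop :=
  ∀ (C : ℝ) (U : ℝ → EuclideanSpace ℝ (Fin 3) → EuclideanSpace ℝ (Fin 3)) (W : Set (ℝ × EuclideanSpace ℝ (Fin 3))),
    Pinned C U → ThickWindow U W → Peakless U →
    (∀ s < 0, ∀ y, ⟪fderiv ℝ (U s) y (Literature.Analysis.FluidPDE.curl (U s) y), EuclideanSpace.single 2 1⟫_ℝ = 0) →
    IsClosed (hotSet U) → (∀ y ∈ hotSet U, fderiv ℝ (fun x => U (-1) x 2) y = 0) →
    (∀ K O : Set (EuclideanSpace ℝ (Fin 3)), IsCompact K → K.Nonempty → K ⊆ hotSet U → IsOpen O → K ⊆ O →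
      O ∩ hotSet U ⊆ K → False) →
    (∀ y ∈ hotSet U, ∀ r : ℝ, 0 < r →
      ∃ y' : EuclideanSpace ℝ (Fin 3), y' 2 = 0 ∧ dist y' y < r ∧ U (-1) y' 2 ≠ U (-1) 0 2) →
    (∀ y ∈ hotSet U, deriv (fun s => U s y 2) (-1) = U (-1) 0 2 / 2) →
    (∀ y ∈ hotSet U, U (-1) 0 2 * lapH U y ≤ 0) →
    (∀ c : ℝ → EuclideanSpace ℝ (Fin 3), Continuous c → (∀ θ : ℝ, c (θ + 1) = c θ) → Set.InjOn c (Set.Ico 0 1) →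
      (∀ θ : ℝ, c θ ∈ hotSet U) → False) →
    (∀ γ : ℝ → EuclideanSpace ℝ (Fin 3), (∀ τ : ℝ, HasDerivAt γ (Literature.Analysis.FluidPDE.curl (U (-1)) (γ τ)) τ) →
      ∀ q ∈ hotSet U, (MapClusterPt q Filter.atTop γ ∨ MapClusterPt q Filter.atBot γ) → ∀ τ : ℝ, γ τ ∈ hotSet U) →
    ∀ (γU : ℝ → EuclideanSpace ℝ (Fin 3)) (δ : ℝ), γU 0 = 0 →
      (∀ σ : ℝ, HasDerivAt γU (Literature.Analysis.FluidPDE.curl (U (-1)) (γU σ)) σ) → (∀ σ : ℝ, γU σ ∈ hotSet U) →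
      0 < δ → (∀ σ : ℝ, δ ≤ ‖Literature.Analysis.FluidPDE.curl (U (-1)) (γU σ)‖) →
      (∃ σs : ℕ → ℝ, Filter.Tendsto σs Filter.atTop Filter.atTop ∧
        (∀ t < 0, TendstoLocallyUniformly (fun k x => U t (x + γU (σs k))) (U t) Filter.atTop) ∧
        TendstoLocallyUniformly (fun k x => Literature.Analysis.FluidPDE.curl (U (-1)) (x + γU (σs k)))
          (Literature.Analysis.FluidPDE.curl (U (-1))) Filter.atTop ∧
        (∀ σ : ℝ, Filter.Tendsto (fun k => γU (σs k + σ) - γU (σs k)) Filter.atTop (nhds (γU σ)))) →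
      (∃ σs : ℕ → ℝ, Filter.Tendsto σs Filter.atTop Filter.atBot ∧
        (∀ t < 0, TendstoLocallyUniformly (fun k x => U t (x + γU (σs k))) (U t) Filter.atTop) ∧
        TendstoLocallyUniformly (fun k x => Literature.Analysis.FluidPDE.curl (U (-1)) (x + γU (σs k)))
          (Literature.Analysis.FluidPDE.curl (U (-1))) Filter.atTop ∧
        (∀ σ : ℝ, Filter.Tendsto (fun k => γU (σs k + σ) - γU (σs k)) Filter.atTop (nhds (γU σ)))) →
      (∀ ε : ℝ, 0 < ε → ∀ R : ℝ, 0 < R → ∃ L : ℝ, 0 < L ∧ ∀ a : ℝ, ∃ σ ∈ Set.Icc a (a + L),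
        ∀ t ∈ Set.Icc (-R) (-R⁻¹), ∀ x ∈ Metric.closedBall (0 : EuclideanSpace ℝ (Fin 3)) R,
          dist (U t (x + γU σ)) (U t x) ≤ ε) →
    False



/-! ## §2 UNIFORM RETURN — the statement just outside the periodic class -/

/-- **UniformReturn** — the profile has TRANSLATION SYMMETRIES IN THE LIMIT, measured in the GLOBAL scale-covariant sup-metric: for every `ε > 0`
there are translations `τ` of arbitrarily large norm with `√(−t)‖U(t, x+τ) − U(t, x)‖ ≤ ε` for ALL `t < 0` and ALL `x`.  Exactly periodic ⇒
UniformReturn (`uniformReturn_of_periodic`); Bohr-almost-periodic in a direction (uniformly in the scale-covariant norm) ⇒ UniformReturn.  hot_hull's H6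
recurrence is the same sentence with «ALL `t < 0`, ALL `x`» replaced by «`t ∈ [−R,−1/R]`, `x ∈ B̄_R`». -/
def UniformReturn (U : ℝ → EuclideanSpace ℝ (Fin 3) → EuclideanSpace ℝ (Fin 3)) : Prop :=
  ∀ ε : ℝ, 0 < ε → ∀ R : ℝ, ∃ τ : EuclideanSpace ℝ (Fin 3), R ≤ ‖τ‖ ∧
    ∀ t : ℝ, t < 0 → ∀ x, Real.sqrt (-t) * ‖U t (x + τ) - U t x‖ ≤ ε

/-- An exactly periodic profile (period `L ≠ 0`) has uniform return (defect `0` along `n • L`). -/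
theorem uniformReturn_of_periodic {U : ℝ → EuclideanSpace ℝ (Fin 3) → EuclideanSpace ℝ (Fin 3)} {L : EuclideanSpace ℝ (Fin 3)} (hL : L ≠ 0)
    (hper : ∀ t < 0, ∀ x, U t (x + L) = U t x) : UniformReturn U := by
  intro ε hε R
  obtain ⟨n, hn⟩ := exists_nat_ge (R / ‖L‖)
  have hLpos : 0 < ‖L‖ := norm_pos_iff.2 hL
  refine ⟨((n : ℤ) : ℝ) • L, ?_, fun t ht x => ?_⟩
  · rw [norm_smul, Real.norm_eq_abs]
    have : (R / ‖L‖) * ‖L‖ = R := div_mul_cancel₀ R hLpos.ne'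
    have habs : |(((n : ℤ) : ℝ))| = (n : ℝ) := by push_cast; exact abs_of_nonneg (Nat.cast_nonneg n)
    rw [habs]
    calc R = (R / ‖L‖) * ‖L‖ := this.symm
      _ ≤ (n : ℝ) * ‖L‖ := mul_le_mul_of_nonneg_right hn hLpos.le
  · have hk := SymmetryModuliCountSymmetricLiouville.periodic_int_smul (f := U t) (e := L) (hper t ht) (n : ℤ) x
    rw [hk, sub_self, norm_zero, mul_zero]
    exact hε.le

/-- **U1a `ReturnWindowSmall` (PROVABLE, M — hand target; template `SymmetryModuliCountSymmetricLiouville.periodicBlowdownVanishing_axis`).**  For a class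
profile `U` and `ε > 0` there are `η > 0`, `R₀` such that every translation `τ` with `‖τ‖ ≥ R₀` and GLOBAL scale-covariant defect `≤ η` makes `U` ε-SMALL
on the time window `[−4‖τ‖², −‖τ‖²]`: `√(−t)‖U(t,x)‖ ≤ ε` there.  Proof (contradiction + blow-down AT THE PERIOD'S OWN SCALE): otherwise there are `τₙ`
(`‖τₙ‖ → ∞`, defects `ηₙ → 0`) and bad points `(sₙ, xₙ)`, `sₙ ∈ [−4‖τₙ‖², −‖τₙ‖²]`, `√(−sₙ)‖U(sₙ,xₙ)‖ > ε`; the zooms `vₙ(s,y) := λₙ U(λₙ² s, xₙ + λₙ y)`,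
`λₙ := √(−sₙ) ∈ [‖τₙ‖, 2‖τₙ‖]`, lie in `A_C` (`isTypeIAncientMild_zoom` + `isTypeIAncientMild_comp_add_right`), have `‖vₙ(−1,0)‖ > ε` and approximate period
`eₙ := τₙ/λₙ`, `‖eₙ‖ ∈ [½, 1]`, with defect `√(−s)‖vₙ(s, y+eₙ) − vₙ(s,y)‖ ≤ ηₙ` (the defect is SCALE-INVARIANT); an F3-limit `w ∈ A_C` (`classCompactness`;
slice-wise locally uniform, uniform slice Lipschitz bounds `exists_norm_iteratedFDeriv_le_of_typeI` to pass `eₙ → e*`) is EXACTLY `e*`-periodic with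
`‖e*‖ ∈ [½,1]`, so `w ≡ 0` by `periodicTypeIAncientLiouville` — contradicting `‖w(−1,0)‖ ≥ ε`.  Why it might fail: only bookkeeping (the subsequence for
`eₙ → e*` and the pointwise-at-`(−1,0)` passage are exactly as in the periodic template). -/
def ReturnWindowSmall : Prop :=
  ∀ (C : ℝ) (U : ℝ → EuclideanSpace ℝ (Fin 3) → EuclideanSpace ℝ (Fin 3)), IsTypeIAncientMild C U →
    ∀ ε : ℝ, 0 < ε → ∃ η : ℝ, 0 < η ∧ ∃ R₀ : ℝ, ∀ τ : EuclideanSpace ℝ (Fin 3), R₀ ≤ ‖τ‖ →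
      (∀ t : ℝ, t < 0 → ∀ x, Real.sqrt (-t) * ‖U t (x + τ) - U t x‖ ≤ η) →
      ∀ t ∈ Set.Icc (-(4 * ‖τ‖ ^ 2)) (-(‖τ‖ ^ 2)), ∀ x, Real.sqrt (-t) * ‖U t x‖ ≤ ε

/-- **U1a BY NAME (v1.1)** — ns-es-p1 g8's `…UniformReturnReturnWindowSmall.returnWindowSmall` (p706563), statement VERBATIM. -/
theorem stub_returnWindowSmall : ReturnWindowSmall :=
  Summit.NavierStokesRegularity.NavierStokesRegularity.Theorems.PoloidalWindowDoorPoloidalWindowRigidityUniformReturnReturnWindowSmall.returnWindowSmall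

/-- **U1b `WindowGap` (PROVABLE, M — hand target; template `SymmetricLiouville.Negative.exists_eps_small_vanishes`, Chae–Wolf 2017 Step 1 / Koch–Tataru
kernel bound (14)).**  For every Type-I constant `C` there is `ε₁ > 0` such that for a class profile `U`, scale-covariant smallness `√(−t)‖U‖ ≤ ε ≤ ε₁` on
ONE time window `[−4T, −T]` propagates FORWARD to `√(−t)‖U‖ ≤ 2ε` on all of `[−4T, 0)`.  Proof: the Oseen identity from `4t` to `t`
(`IsTypeIAncientMild.mild_eq`): heat part `≤ ½·(bound at 4t)` (sup-norm contraction, `√(−t)/√(−4t) = ½`), Duhamel part over the known stretch `≤ K₀·(2ε)²`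
(`exists_norm_oseenKernel_le`, `ChaeWolf.norm_integral_oseenKernel_le`), Duhamel part over the short unknown stretch `[t₁, t₁(1−η)]` `≤ c·C²·√η ≤ ε/2` by the
a-priori Type-I bound; so `B ≤ ε + 4K₀ε² + ε/2 < 2ε` for `ε ≤ ε₁ := 1/(16K₀+1)`, and the geometric time steps `tⱼ₊₁ = (1−η)tⱼ → 0⁻` exhaust `[−T, 0)`
(no continuity-in-`t` of the sup needed).  Why it might fail: only if the short-stretch constant were not uniform — it is (`η = η(C, ε)` fixed per step,
the kernel's `L¹`-in-space norm is `≲ (t−s)^{-1/2}`). -/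
def WindowGap : Prop :=
  ∀ C : ℝ, ∃ ε₁ : ℝ, 0 < ε₁ ∧ ∀ (U : ℝ → EuclideanSpace ℝ (Fin 3) → EuclideanSpace ℝ (Fin 3)), IsTypeIAncientMild C U →
    ∀ (T ε : ℝ), 0 < T → 0 < ε → ε ≤ ε₁ →
      (∀ t ∈ Set.Icc (-(4 * T)) (-T), ∀ x, Real.sqrt (-t) * ‖U t x‖ ≤ ε) →
      ∀ t : ℝ, -(4 * T) ≤ t → t < 0 → ∀ x, Real.sqrt (-t) * ‖U t x‖ ≤ 2 * ε

/-- **U1b BY NAME (v1.1)** — ns-es-p1 g8's `…UniformReturnWindowGap.windowGap` (p705972), statement VERBATIM. -/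
theorem stub_windowGap : WindowGap :=
  Summit.NavierStokesRegularity.NavierStokesRegularity.Theorems.PoloidalWindowDoorPoloidalWindowRigidityUniformReturnWindowGap.windowGap

/-- **U1 `uniformReturn_liouville` — ASYMPTOTIC TRANSLATION SYMMETRY KILLS A CLASS PROFILE (checked composition U1a ∧ U1b ⇒ U1, no sorry).**
A Type-I ancient mild profile with uniform return vanishes identically on `t < 0`: given `(t, x)` and `ε ≤ ε₁`, U1a provides `η, R₀`; UniformReturn
provides `τ` with `‖τ‖ ≥ max(R₀, √(−t))` and defect `≤ η`; U1a makes `U` ε-small on `[−4‖τ‖², −‖τ‖²]`; U1b propagates `2ε`-smallness to `[−4‖τ‖², 0) ∋ t`;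
`ε → 0`. -/
theorem uniformReturn_liouville (hA : ReturnWindowSmall) (hB : WindowGap) {C : ℝ}
    {U : ℝ → EuclideanSpace ℝ (Fin 3) → EuclideanSpace ℝ (Fin 3)} (hU : IsTypeIAncientMild C U) (hR : UniformReturn U) :
    ∀ t < 0, ∀ x, U t x = 0 := by
  intro t ht x
  obtain ⟨ε₁, hε₁, hgap⟩ := hB C
  have hst0 : 0 < Real.sqrt (-t) := Real.sqrt_pos.2 (by linarith)
  -- the key estimate: for every admissible ε, the scale-covariant size at (t, x) is ≤ 2ε
  have key : ∀ ε : ℝ, 0 < ε → ε ≤ ε₁ → Real.sqrt (-t) * ‖U t x‖ ≤ 2 * ε := by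
    intro ε hε hεle
    obtain ⟨η, hη, R₀, hwin⟩ := hA C U hU ε hε
    obtain ⟨τ, hτR, hτdef⟩ := hR η hη (max R₀ (Real.sqrt (-t)))
    have hR₀ : R₀ ≤ ‖τ‖ := le_trans (le_max_left _ _) hτR
    have hst : Real.sqrt (-t) ≤ ‖τ‖ := le_trans (le_max_right _ _) hτR
    have hτpos : 0 < ‖τ‖ := lt_of_lt_of_le hst0 hst
    have hT : 0 < ‖τ‖ ^ 2 := by positivity
    have hsmall : ∀ s ∈ Set.Icc (-(4 * ‖τ‖ ^ 2)) (-(‖τ‖ ^ 2)), ∀ y, Real.sqrt (-s) * ‖U s y‖ ≤ ε :=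
      hwin τ hR₀ hτdef
    have hle : -(4 * ‖τ‖ ^ 2) ≤ t := by
      have h1 : -t ≤ ‖τ‖ ^ 2 := by
        have h2 : Real.sqrt (-t) ^ 2 = -t := Real.sq_sqrt (by linarith)
        nlinarith [hst, hst0]
      nlinarith [hT]
    exact hgap U hU (‖τ‖ ^ 2) ε hT hε hεle hsmall t hle ht x
  -- ε → 0
  by_contra hne
  have hpos : 0 < ‖U t x‖ := norm_pos_iff.2 hne
  have hprod : 0 < Real.sqrt (-t) * ‖U t x‖ := mul_pos hst0 hpos
  set a : ℝ := Real.sqrt (-t) * ‖U t x‖ with ha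
  have h := key (min ε₁ (a / 4)) (lt_min hε₁ (by positivity)) (min_le_left _ _)
  have hmin : min ε₁ (a / 4) ≤ a / 4 := min_le_right _ _
  linarith

/-! ## §3 Corners BY NAME (no sorry): exactly periodic, germ-returning, and the column-wide export -/

/-- The class of a pinned profile (tree `isTypeIAncientMild_of_class`, from the first four clauses of `Pinned`). -/
theorem class_of_pinned {C : ℝ} {U : ℝ → EuclideanSpace ℝ (Fin 3) → EuclideanSpace ℝ (Fin 3)} (hP : Pinned C U) : IsTypeIAncientMild C U :=
  PoloidalWindowDoorPoloidalWindowRigidityWindow.isTypeIAncientMild_of_class hP.1 hP.2.1 hP.2.2.1 hP.2.2.2.1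

/-- A pinned profile is not identically zero (`N = U₂(−1,0) ≠ 0`). -/
theorem pinned_absurd_of_zero {C : ℝ} {U : ℝ → EuclideanSpace ℝ (Fin 3) → EuclideanSpace ℝ (Fin 3)} (hP : Pinned C U)
    (hz : ∀ t < 0, ∀ x, U t x = 0) : False := by
  have hN : U (-1) 0 2 ≠ 0 := hP.2.2.2.2.2.1
  have h0 : U (-1) 0 = 0 := hz (-1) (by norm_num) 0
  exact hN (by rw [h0]; rfl)

/-- **Corner P — PERIODIC RETURN is absurd (BY NAME `FrequencyGrowthExponent.Negative.eq_zero_of_periodic`).**  hot_hull v1.5's named cheapest falsifier of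
RECURRENT-LEAF, «a translation-periodic member of 𝒫 with a persistent hot vortex line», does not exist: no pinned profile is periodic. -/
theorem periodicReturn_absurd {C : ℝ} {U : ℝ → EuclideanSpace ℝ (Fin 3) → EuclideanSpace ℝ (Fin 3)} (hP : Pinned C U)
    {L : EuclideanSpace ℝ (Fin 3)} (hL : L ≠ 0) (hper : ∀ t < 0, ∀ x, U t (x + L) = U t x) : False :=
  pinned_absurd_of_zero hP
    (FrequencyGrowthExponent.Negative.eq_zero_of_periodic hP.1 hP.2.1 hP.2.2.1 hP.2.2.2.1 hL hper)

/-- **Corner G — a GERM RETURN is absurd (BY NAME `germRigidity` + `isTypeIAncientMild_comp_add_right` + corner P).**  If ONE translate `U(·, · + p)`,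
`p ≠ 0`, agrees with `U` on ONE non-empty open set at ONE time `t₀ < 0`, then (joint real-analyticity of the class) it agrees on the whole past, `U` is
`p`-periodic, and corner P applies.  So every return of the recurrent leaf is INEXACT on every open ball at every time. -/
theorem germReturn_absurd {C : ℝ} {U : ℝ → EuclideanSpace ℝ (Fin 3) → EuclideanSpace ℝ (Fin 3)} (hP : Pinned C U)
    {p : EuclideanSpace ℝ (Fin 3)} (hp : p ≠ 0) {t₀ : ℝ} (ht₀ : t₀ < 0) {O : Set (EuclideanSpace ℝ (Fin 3))} (hO : IsOpen O)
    (hne : O.Nonempty) (heq : ∀ x ∈ O, U t₀ (x + p) = U t₀ x) : False := by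
  have hU := class_of_pinned hP
  have hUp : IsTypeIAncientMild C (fun t x => U t (x + p)) :=
    SymmetryModuliCountSymmetricLiouville.isTypeIAncientMild_comp_add_right hU p
  refine periodicReturn_absurd hP hp fun t ht x => ?_
  have h : (fun t x => U t (x + p)) t x = U t x := germRigidity hUp hU ht₀ hO hne (fun x hx => heq x hx) ht x
  exact h

/-- **Column-wide export — NO PINNED PROFILE HAS UNIFORM RETURN (from U1; no sorry beyond U1a/U1b).**  Every research cell of the THICK column
(hot_hull: NULL-CONTINUUM, RECURRENT-LEAF, OSCILLATING-END; hot_forest: CONVERGENT-WEB; hot_split: C2b′), S0's (TH) profiles and the wall's `W` are about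
PINNED profiles, so each may add `¬ UniformReturn` to its hypotheses for free. -/
theorem pinned_not_uniformReturn (hA : ReturnWindowSmall) (hB : WindowGap) {C : ℝ}
    {U : ℝ → EuclideanSpace ℝ (Fin 3) → EuclideanSpace ℝ (Fin 3)} (hP : Pinned C U) : ¬ UniformReturn U :=
  fun hR => pinned_absurd_of_zero hP (uniformReturn_liouville hA hB (class_of_pinned hP) hR)

/-! ## §4 The cut of RECURRENT-LEAF: UNIFORM-RETURN-LEAF (closed) and DEFECTIVE-RETURN-LEAF (open, research) -/

/-- **CELL UNIFORM-RETURN-LEAF `CellUniformReturnLeaf` (CLOSED below from U1).**  Every binder of hot_hull v1.6's `CellRecurrentLeaf` VERBATIM, plus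
`UniformReturn U`: the recurrent leaf whose returns (or any escaping translations) are good in the GLOBAL scale-covariant metric.  Contains the periodic,
quasi-periodic, Bohr-almost-periodic and germ-returning sub-cases. -/
def CellUniformReturnLeaf : Prop :=
  ∀ (C : ℝ) (U : ℝ → EuclideanSpace ℝ (Fin 3) → EuclideanSpace ℝ (Fin 3)) (W : Set (ℝ × EuclideanSpace ℝ (Fin 3))),
    Pinned C U → ThickWindow U W → Peakless U →
    (∀ s < 0, ∀ y, ⟪fderiv ℝ (U s) y (Literature.Analysis.FluidPDE.curl (U s) y), EuclideanSpace.single 2 1⟫_ℝ = 0) →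
    IsClosed (hotSet U) → (∀ y ∈ hotSet U, fderiv ℝ (fun x => U (-1) x 2) y = 0) →
    (∀ K O : Set (EuclideanSpace ℝ (Fin 3)), IsCompact K → K.Nonempty → K ⊆ hotSet U → IsOpen O → K ⊆ O →
      O ∩ hotSet U ⊆ K → False) →
    (∀ y ∈ hotSet U, ∀ r : ℝ, 0 < r →
      ∃ y' : EuclideanSpace ℝ (Fin 3), y' 2 = 0 ∧ dist y' y < r ∧ U (-1) y' 2 ≠ U (-1) 0 2) →
    (∀ y ∈ hotSet U, deriv (fun s => U s y 2) (-1) = U (-1) 0 2 / 2) →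
    (∀ y ∈ hotSet U, U (-1) 0 2 * lapH U y ≤ 0) →
    (∀ c : ℝ → EuclideanSpace ℝ (Fin 3), Continuous c → (∀ θ : ℝ, c (θ + 1) = c θ) → Set.InjOn c (Set.Ico 0 1) →
      (∀ θ : ℝ, c θ ∈ hotSet U) → False) →
    (∀ γ : ℝ → EuclideanSpace ℝ (Fin 3), (∀ τ : ℝ, HasDerivAt γ (Literature.Analysis.FluidPDE.curl (U (-1)) (γ τ)) τ) →
      ∀ q ∈ hotSet U, (MapClusterPt q Filter.atTop γ ∨ MapClusterPt q Filter.atBot γ) → ∀ τ : ℝ, γ τ ∈ hotSet U) →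
    ∀ (γU : ℝ → EuclideanSpace ℝ (Fin 3)) (δ : ℝ), γU 0 = 0 →
      (∀ σ : ℝ, HasDerivAt γU (Literature.Analysis.FluidPDE.curl (U (-1)) (γU σ)) σ) → (∀ σ : ℝ, γU σ ∈ hotSet U) →
      0 < δ → (∀ σ : ℝ, δ ≤ ‖Literature.Analysis.FluidPDE.curl (U (-1)) (γU σ)‖) →
      (∃ σs : ℕ → ℝ, Filter.Tendsto σs Filter.atTop Filter.atTop ∧
        (∀ t < 0, TendstoLocallyUniformly (fun k x => U t (x + γU (σs k))) (U t) Filter.atTop) ∧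
        TendstoLocallyUniformly (fun k x => Literature.Analysis.FluidPDE.curl (U (-1)) (x + γU (σs k)))
          (Literature.Analysis.FluidPDE.curl (U (-1))) Filter.atTop ∧
        (∀ σ : ℝ, Filter.Tendsto (fun k => γU (σs k + σ) - γU (σs k)) Filter.atTop (nhds (γU σ)))) →
      (∃ σs : ℕ → ℝ, Filter.Tendsto σs Filter.atTop Filter.atBot ∧
        (∀ t < 0, TendstoLocallyUniformly (fun k x => U t (x + γU (σs k))) (U t) Filter.atTop) ∧
        TendstoLocallyUniformly (fun k x => Literature.Analysis.FluidPDE.curl (U (-1)) (x + γU (σs k)))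
          (Literature.Analysis.FluidPDE.curl (U (-1))) Filter.atTop ∧
        (∀ σ : ℝ, Filter.Tendsto (fun k => γU (σs k + σ) - γU (σs k)) Filter.atTop (nhds (γU σ)))) →
      (∀ ε : ℝ, 0 < ε → ∀ R : ℝ, 0 < R → ∃ L : ℝ, 0 < L ∧ ∀ a : ℝ, ∃ σ ∈ Set.Icc a (a + L),
        ∀ t ∈ Set.Icc (-R) (-R⁻¹), ∀ x ∈ Metric.closedBall (0 : EuclideanSpace ℝ (Fin 3)) R,
          dist (U t (x + γU σ)) (U t x) ≤ ε) →
    UniformReturn U → False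

/-- **CELL DEFECTIVE-RETURN-LEAF `CellDefectiveReturnLeaf` (OPEN, research) — RECURRENT-LEAF minus UNIFORM RETURN.**  Every binder of hot_hull v1.6's
`CellRecurrentLeaf` VERBATIM (pinned THICK peakless `U`, hot laws, complete hot leaf `γU` through `0` with `|ω_U| ≥ δ` along it, two-sided syndetic
recurrence under sliding in the compact-open topology), plus `¬ UniformReturn U`: there are `ε₀ > 0` and `R₀` such that EVERY translation `τ` with
`‖τ‖ ≥ R₀` — in particular every hull return `γU(σₖ)` of H6 — has GLOBAL scale-covariant defect `sup_{t<0,x} √(−t)‖U(t,x+τ) − U(t,x)‖ > ε₀`, while the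
hull returns converge on every compact subset of `(−∞,0) × ℝ³`: the defect of the k-th return is realised at space-time points that leave every compact —
FAR FIELD (`|x| → ∞` at bounded `t`), FAR PAST (`t → −∞`) or the BLOW-UP CORNER (`t → 0⁻`).  Corners dead by name: exact period (P), exact germ return (G).
Killing quantity missing (honest): a Liouville theorem for Type-I ancient profiles recurrent in the compact-open sense along an unbounded hot curve whose
almost-periods all fail globally; v1.1 menu: (i) exclude the blow-up-corner alternative at bounded `x` by local forward continuous dependence with `O(1/R)`
Oseen leakage (provable, L); (ii) FAR-PAST defects meet the blow-down hull of `U` (ETERNALLY-HOT / COOLING-PAST dichotomy, LINE 23); (iii) FAR-FIELD defects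
at bounded times meet the zero-mode law (LINE 16: box means of hull members vanish). -/
def CellDefectiveReturnLeaf : Prop :=
  ∀ (C : ℝ) (U : ℝ → EuclideanSpace ℝ (Fin 3) → EuclideanSpace ℝ (Fin 3)) (W : Set (ℝ × EuclideanSpace ℝ (Fin 3))),
    Pinned C U → ThickWindow U W → Peakless U →
    (∀ s < 0, ∀ y, ⟪fderiv ℝ (U s) y (Literature.Analysis.FluidPDE.curl (U s) y), EuclideanSpace.single 2 1⟫_ℝ = 0) →
    IsClosed (hotSet U) → (∀ y ∈ hotSet U, fderiv ℝ (fun x => U (-1) x 2) y = 0) →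
    (∀ K O : Set (EuclideanSpace ℝ (Fin 3)), IsCompact K → K.Nonempty → K ⊆ hotSet U → IsOpen O → K ⊆ O →
      O ∩ hotSet U ⊆ K → False) →
    (∀ y ∈ hotSet U, ∀ r : ℝ, 0 < r →
      ∃ y' : EuclideanSpace ℝ (Fin 3), y' 2 = 0 ∧ dist y' y < r ∧ U (-1) y' 2 ≠ U (-1) 0 2) →
    (∀ y ∈ hotSet U, deriv (fun s => U s y 2) (-1) = U (-1) 0 2 / 2) →
    (∀ y ∈ hotSet U, U (-1) 0 2 * lapH U y ≤ 0) →
    (∀ c : ℝ → EuclideanSpace ℝ (Fin 3), Continuous c → (∀ θ : ℝ, c (θ + 1) = c θ) → Set.InjOn c (Set.Ico 0 1) →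
      (∀ θ : ℝ, c θ ∈ hotSet U) → False) →
    (∀ γ : ℝ → EuclideanSpace ℝ (Fin 3), (∀ τ : ℝ, HasDerivAt γ (Literature.Analysis.FluidPDE.curl (U (-1)) (γ τ)) τ) →
      ∀ q ∈ hotSet U, (MapClusterPt q Filter.atTop γ ∨ MapClusterPt q Filter.atBot γ) → ∀ τ : ℝ, γ τ ∈ hotSet U) →
    ∀ (γU : ℝ → EuclideanSpace ℝ (Fin 3)) (δ : ℝ), γU 0 = 0 →
      (∀ σ : ℝ, HasDerivAt γU (Literature.Analysis.FluidPDE.curl (U (-1)) (γU σ)) σ) → (∀ σ : ℝ, γU σ ∈ hotSet U) →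
      0 < δ → (∀ σ : ℝ, δ ≤ ‖Literature.Analysis.FluidPDE.curl (U (-1)) (γU σ)‖) →
      (∃ σs : ℕ → ℝ, Filter.Tendsto σs Filter.atTop Filter.atTop ∧
        (∀ t < 0, TendstoLocallyUniformly (fun k x => U t (x + γU (σs k))) (U t) Filter.atTop) ∧
        TendstoLocallyUniformly (fun k x => Literature.Analysis.FluidPDE.curl (U (-1)) (x + γU (σs k)))
          (Literature.Analysis.FluidPDE.curl (U (-1))) Filter.atTop ∧
        (∀ σ : ℝ, Filter.Tendsto (fun k => γU (σs k + σ) - γU (σs k)) Filter.atTop (nhds (γU σ)))) →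
      (∃ σs : ℕ → ℝ, Filter.Tendsto σs Filter.atTop Filter.atBot ∧
        (∀ t < 0, TendstoLocallyUniformly (fun k x => U t (x + γU (σs k))) (U t) Filter.atTop) ∧
        TendstoLocallyUniformly (fun k x => Literature.Analysis.FluidPDE.curl (U (-1)) (x + γU (σs k)))
          (Literature.Analysis.FluidPDE.curl (U (-1))) Filter.atTop ∧
        (∀ σ : ℝ, Filter.Tendsto (fun k => γU (σs k + σ) - γU (σs k)) Filter.atTop (nhds (γU σ)))) →
      (∀ ε : ℝ, 0 < ε → ∀ R : ℝ, 0 < R → ∃ L : ℝ, 0 < L ∧ ∀ a : ℝ, ∃ σ ∈ Set.Icc a (a + L),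
        ∀ t ∈ Set.Icc (-R) (-R⁻¹), ∀ x ∈ Metric.closedBall (0 : EuclideanSpace ℝ (Fin 3)) R,
          dist (U t (x + γU σ)) (U t x) ≤ ε) →
    ¬ UniformReturn U → False

/-- **stub DEFECTIVE-RETURN-LEAF** (OPEN, research). -/
theorem stub_cellDefectiveReturnLeaf : CellDefectiveReturnLeaf := by
  sorry

/-- **UNIFORM-RETURN-LEAF is CLOSED** (from U1 = U1a ∧ U1b; no sorry of its own): a pinned profile with uniform return vanishes, contradicting `N ≠ 0`. -/
theorem cellUniformReturnLeaf_of (hA : ReturnWindowSmall) (hB : WindowGap) : CellUniformReturnLeaf := by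
  intro C U W h1 h2 h3 h4 h5 h6 h7 h8 h9 h10 h11 h12 γU δ g1 g2 g3 g4 g5 g6 g7 g8 hu
  exact pinned_not_uniformReturn hA hB h1 hu

/-! ## §5 Kernel (checked, no sorry): RECURRENT-LEAF ⇐ U1a ∧ U1b ∧ DEFECTIVE-RETURN-LEAF -/

/-- **Kernel of LINE 22.**  hot_hull v1.6's research cell `CellRecurrentLeaf` (VERBATIM) follows from the two hand stubs U1a, U1b and the ONE research
residue `CellDefectiveReturnLeaf` — excluded middle on `UniformReturn U`, the uniform half closed by `cellUniformReturnLeaf_of`. -/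
theorem cellRecurrentLeaf_of_defective (hA : ReturnWindowSmall) (hB : WindowGap) (hD : CellDefectiveReturnLeaf) : CellRecurrentLeaf := by
  intro C U W h1 h2 h3 h4 h5 h6 h7 h8 h9 h10 h11 h12 γU δ g1 g2 g3 g4 g5 g6 g7 g8
  by_cases hu : UniformReturn U
  · exact cellUniformReturnLeaf_of hA hB C U W h1 h2 h3 h4 h5 h6 h7 h8 h9 h10 h11 h12 γU δ g1 g2 g3 g4 g5 g6 g7 g8 hu
  · exact hD C U W h1 h2 h3 h4 h5 h6 h7 h8 h9 h10 h11 h12 γU δ g1 g2 g3 g4 g5 g6 g7 g8 hu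

/-- **The line's deliverable in one statement**: with the two M-sized hand stubs discharged, RECURRENT-LEAF of hot_hull reduces to DEFECTIVE-RETURN-LEAF. -/
theorem cellRecurrentLeaf_of_stubs (hD : CellDefectiveReturnLeaf) : CellRecurrentLeaf :=
  cellRecurrentLeaf_of_defective stub_returnWindowSmall stub_windowGap hD

end Summit.NavierStokesRegularity.NavierStokesRegularity.Cruxes.PoloidalWindowRigidity.UniformReturn
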